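import Literature.AnabelianGeometry.AbsoluteAnabelian.NFDecompositionNestedProofs
import Literature.NumberTheory.GaloisRepresentations.DecompositionGroupsDistinctPlaces
import HarnessLib

/-!
# [AbsAnab] §1.1 / [NSW] Cor. 12.1.3: distinct nonarchimedean primes of `F̄` have non-commensurable
# decomposition groups — valuation-subring form

Mochizuki, *The absolute anabelian geometry of hyperbolic curves* (2004), §1.1, Thm. 1.1.1 (i)
(`G_𝔭 ⊆ G_F` commensurably terminal, "a formal consequence of [NSW], Corollary 12.1.3");
Neukirch–Schmidt–Wingberg, *Cohomology of Number Fields*, Cor. 12.1.3.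

PROOF-ONLY companion (0 `def`s) of `MLFGaloisGroups.lean` (`decompositionGroupNF F A`, the
decomposition group `G_𝔭` of a nonarchimedean prime `𝔭` of `F̄` = a valuation subring `A ≠ ⊤`):
the trunk theorem `eq_of_relIndex_decompositionSubgroup_ne_zero`
(`NumberTheory/GaloisRepresentations/DecompositionGroupsDistinctPlaces.lean`, primes of `\bar ℤ_F`)
transported to valuation subrings through the dictionary of `NFDecompositionCommTerminalProofs.lean`
and `NFDecompositionNestedProofs.valuationSubring_le_of_forall_mem_iff`:

* **`eq_of_relIndex_decompositionGroupNF_ne_zero`** — if `G_A ∩ G_B` has finite index in `G_A`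
  (`(G_B).relIndex (G_A) ≠ 0`), then `A = B`; this sharpens Thm. 1.1.1 (i) (which is the case
  `B = σ A`) to arbitrary pairs of nonarchimedean primes;
* `relIndex_decompositionGroupNF_eq_zero_of_ne`, `not_commensurable_decompositionGroupNF_of_ne` —
  the same in the forms `A ≠ B ⇒ (G_B).relIndex (G_A) = 0` and `¬ Commensurable G_B G_A`.

HONEST FRAMING: classical algebraic number theory (our kernel check); abc-iut GAP row G-L4d2g4-1
(«campaign L», uniqueness half); nothing here bears on [IUTchIII] Cor. 3.12.
-/

noncomputable section

open scoped NumberField Pointwise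
open Field IsDedekindDomain Literature.NumberTheory.GaloisRepresentations

namespace Literature.AnabelianGeometry.AbsoluteAnabelian

variable {F : Type} [Field F] [NumberField F]

/-- **[NSW] Cor. 12.1.3 for nonarchimedean primes of `F̄` (valuation-subring form).**  For a number
field `F` and nontrivial valuation subrings `A, B ≠ ⊤` of `F̄`: if `G_A ∩ G_B` has finite index in
`G_A`, then `A = B`.  Via the primes `𝔓_A, 𝔓_B` of `\bar ℤ_F` (`exists_ideal_mem_primesAbove_of_ne_top`,
`decompositionGroupNF_eq_decompositionSubgroup`), the trunk's `eq_of_relIndex_decompositionSubgroup_ne_zero`,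
and recovery of `A` from `𝔓_A` (`valuationSubring_le_of_forall_mem_iff`).
[cite: NeukirchSchmidtWingberg2008, Cor. 12.1.3] -/
theorem eq_of_relIndex_decompositionGroupNF_ne_zero (A B : ValuationSubring (AlgebraicClosure F))
    (hA : A ≠ ⊤) (hB : B ≠ ⊤)
    (h : (decompositionGroupNF F B).relIndex (decompositionGroupNF F A) ≠ 0) : A = B := by
  obtain ⟨v, 𝔓, h𝔓v, h𝔓⟩ := exists_ideal_mem_primesAbove_of_ne_top A hA
  obtain ⟨w, 𝔔, h𝔔w, h𝔔⟩ := exists_ideal_mem_primesAbove_of_ne_top B hB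
  rw [decompositionGroupNF_eq_decompositionSubgroup A 𝔓 h𝔓,
    decompositionGroupNF_eq_decompositionSubgroup B 𝔔 h𝔔] at h
  have e := eq_of_relIndex_decompositionSubgroup_ne_zero F h𝔓v h𝔔w h
  subst e
  exact le_antisymm (valuationSubring_le_of_forall_mem_iff A B 𝔓 h𝔓 h𝔔)
    (valuationSubring_le_of_forall_mem_iff B A 𝔓 h𝔔 h𝔓)

/-- Distinct nonarchimedean primes `A ≠ B` of `F̄` have `G_A ∩ G_B` of infinite index in `G_A`:
`(G_B).relIndex (G_A) = 0`. [cite: NeukirchSchmidtWingberg2008, Cor. 12.1.3] -/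
theorem relIndex_decompositionGroupNF_eq_zero_of_ne (A B : ValuationSubring (AlgebraicClosure F))
    (hA : A ≠ ⊤) (hB : B ≠ ⊤) (hne : A ≠ B) :
    (decompositionGroupNF F B).relIndex (decompositionGroupNF F A) = 0 := by
  by_contra h
  exact hne (eq_of_relIndex_decompositionGroupNF_ne_zero A B hA hB h)

/-- Distinct nonarchimedean primes of `F̄` have non-commensurable decomposition groups (Mathlib
`Subgroup.Commensurable`); in particular `G_𝔭` is commensurably terminal ([AbsAnab] Thm. 1.1.1 (i),
the case of conjugate primes). [cite: MochizukiAbsAnab2004, Thm 1.1.1 (i) p.6] -/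
theorem not_commensurable_decompositionGroupNF_of_ne (A B : ValuationSubring (AlgebraicClosure F))
    (hA : A ≠ ⊤) (hB : B ≠ ⊤) (hne : A ≠ B) :
    ¬ Subgroup.Commensurable (decompositionGroupNF F B) (decompositionGroupNF F A) := fun h =>
  h.1 (relIndex_decompositionGroupNF_eq_zero_of_ne A B hA hB hne)

end Literature.AnabelianGeometry.AbsoluteAnabelian

end
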